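import Summits.FinalStateConjecture.FinalStateConjecture.Theses.ZeroEnergyKerrOrBomb
import Literature.Geometry.Lorentzian.StationaryBlackHoleUniquenessProofs

/-!
# `ZeroEnergyRigidity` (crux `stmt-FinalStateConjecture-10690`): hypothesis h5 is redundant

Negative-lane load-bearing analysis for the crux `ZeroEnergyRigidity` of route
`ZeroEnergyKerrOrBomb` (cdisprove seat, cycle 2).  The crux quantifies over stationary
asymptotically flat black holes `𝓑 : StationaryAFBlackHole` with hypotheses
h1 vacuum, h2 `𝓔⁺` connected, h3 `𝓔⁺` non-degenerate, h4 the carrier globally hyperbolic,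
h5 `∀ p ∈ 𝓑.doc, 𝓑.killing p ≠ 0`, h6 no imprisoned zero-energy null ray.

**h5 follows from h4 for every presentation** (`killing_ne_zero_of_mem_doc_of_isGloballyHyperbolic`):
global hyperbolicity contains the causality condition, hence chronology, and by Chruściel–Costa
2008, Cor. 3.8 — PROVED in the tree as `StationaryAFBlackHole.killing_ne_zero_of_mem_doc`
(`Literature.Geometry.Lorentzian.StationaryBlackHoleUniquenessProofs`: a zero of the complete
stationary Killing field in the d.o.c. is a compact flow-invariant set, which Lemma 3.7 turns into
a closed timelike curve) — a chronological d.o.c. carries no zero of `T`.  Only the chronology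
clause of h4 is used (`killing_ne_zero_of_mem_doc_of_isChronological`).

Consequence (pure logic, `zeroEnergyRigidity_iff_withoutH5`): the crux is equivalent to the same
statement with h5 deleted.  For provers: `T ≠ 0` on the d.o.c. is free; for the planner: h5 is
decoration and may be dropped at the next restate.

References: P. T. Chruściel, J. L. Costa, *On uniqueness of stationary vacuum black holes*,
Astérisque 321 (2008), Lemma 3.7 and Cor. 3.8 (arXiv:0806.0016, §3).
-/

namespace Summit.FinalStateConjecture.FinalStateConjecture.Theorems.ZeroEnergyRigidity.Negative

open Literature.Geometry.Lorentzian
open scoped Manifold ContDiff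
open Summit.FinalStateConjecture.FinalStateConjecture.Theses.ZeroEnergyKerrOrBomb (ZeroEnergyRigidity)

universe u

/-- **A chronological stationary black hole has `T ≠ 0` on its d.o.c.** (Chruściel–Costa 2008,
Cor. 3.8, in the tree's rendering `StationaryAFBlackHole.killing_ne_zero_of_mem_doc`, with the
chronology hypothesis unfolded by `isChronological_iff`). [cite: ChruscielCosta2008, Cor. 3.8] -/
theorem killing_ne_zero_of_mem_doc_of_isChronological (𝓑 : StationaryAFBlackHole.{u})
    [𝓑.metric.HasLeviCivita] (h : 𝓑.metric.IsChronological 𝓑.timeOrientation)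
    {p : 𝓑.carrier} (hp : p ∈ 𝓑.doc) : 𝓑.killing p ≠ 0 :=
  StationaryAFBlackHole.killing_ne_zero_of_mem_doc
    (fun q _ ↦ (LorentzianMetric.isChronological_iff.mp h) q) hp

/-- **h4 ⇒ h5**: on a globally hyperbolic carrier (causal, hence chronological) the stationary
Killing field has no zero in the d.o.c. — hypothesis h5 of `ZeroEnergyRigidity` is implied by
hypothesis h4, for every presentation `𝓑`. [cite: ChruscielCosta2008, Cor. 3.8] -/
theorem killing_ne_zero_of_mem_doc_of_isGloballyHyperbolic (𝓑 : StationaryAFBlackHole.{u})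
    [𝓑.metric.HasLeviCivita] (h4 : 𝓑.metric.IsGloballyHyperbolic 𝓑.timeOrientation)
    {p : 𝓑.carrier} (hp : p ∈ 𝓑.doc) : 𝓑.killing p ≠ 0 :=
  killing_ne_zero_of_mem_doc_of_isChronological 𝓑 h4.isCausallyWellBehaved.isChronological hp

/-- **`ZeroEnergyRigidity` is equivalent to itself with h5 deleted** (the right-hand side is the
served statement of `stmt-FinalStateConjecture-10690` verbatim, minus the binder
`(∀ p ∈ 𝓑.doc, 𝓑.killing p ≠ 0) →`).  Pure logic over
`killing_ne_zero_of_mem_doc_of_isGloballyHyperbolic`. [folklore] -/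
theorem zeroEnergyRigidity_iff_withoutH5 :
    ZeroEnergyRigidity ↔
      ∀ (𝓑 : StationaryAFBlackHole.{0}) [𝓑.metric.HasLeviCivita] [Kerr.Facts],
        𝓑.metric.toPseudoRiemannianMetric.IsRicciFlat → IsConnected 𝓑.horizon →
        𝓑.toSpacetime.IsNonDegenerateHorizon 𝓑.Mext →
        𝓑.metric.IsGloballyHyperbolic 𝓑.timeOrientation →
        (∀ γ : ℝ → 𝓑.carrier, IsGeodesicOn 𝓑.metric.leviCivita γ (Set.Ici 0) →
          (∀ s : ℝ, 0 ≤ s → 𝓑.metric.IsNull (velocity (𝓡 4) γ s) ∧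
            𝓑.metric.val (γ s) (𝓑.killing (γ s)) (velocity (𝓡 4) γ s) = 0) →
          ∀ K : Set 𝓑.carrier, IsCompact K → K ⊆ 𝓑.doc → ∃ s : ℝ, 0 ≤ s ∧ γ s ∉ K) →
        ∃ (M a : ℝ), Kerr.IsSubextremal M a ∧ ∃ Ψ : Kerr.exterior M a → 𝓑.carrier,
          Function.Injective Ψ ∧ Set.range Ψ = 𝓑.doc ∧
            PseudoRiemannianMetric.IsIsometricImmersion
              (Kerr.smoothMetric M a (Kerr.rPlus M a)).toPseudoRiemannianMetric
              𝓑.metric.toPseudoRiemannianMetric Ψ :=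
  ⟨fun h 𝓑 _ _ h1 h2 h3 h4 h6 ↦
      h 𝓑 h1 h2 h3 h4 (fun _ hp ↦ killing_ne_zero_of_mem_doc_of_isGloballyHyperbolic 𝓑 h4 hp) h6,
    fun h 𝓑 _ _ h1 h2 h3 h4 _ h6 ↦ h 𝓑 h1 h2 h3 h4 h6⟩

end Summit.FinalStateConjecture.FinalStateConjecture.Theorems.ZeroEnergyRigidity.Negative
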